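import Mathlib.Data.Matrix.Basic
import Mathlib.Analysis.SpecialFunctions.Pow.Real
import Mathlib.Algebra.BigOperators.Intervals
import HarnessLib

/-!
# Dimock, *Quantum electrodynamics on the 3-torus II*, §1.2.4 (25)–(26) and §1.3.4 (49)–(50): KERNELS UNDER THE
# RESCALING `σ_L` — `(σ_L^{−1}G_kσ_L)(x,x′) = L³G_k(Lx,Lx′)`, `σ^T_{L^{−1}} = L^{−2}σ_L` (bosons), `(σ_L^{−1})^T = L^{−1}σ_L`
# (fermions), hence `G_{k+1}(x,x′) = L(G_k + H_kC_kH_k^T)(Lx,Lx′)` (25), `S_{k+1}(A,x,x′) = L²(…)(Lx,Lx′)` (49) and the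
# iterated forms (26) ∕ (50) — PROVED as the weighted-kernel bookkeeping they are (index coordinates)

statement-level skeleton of published theorems with citation tags; proofs where landed; nothing here is a claim about the Yang–Mills mass gap

(Writer seat p11 = literature-prover-lit-balaban-p11-g21-0; YM LIT SWEEP item (c), Lean lane — zero weight for the
YM-INPRINT tokens of row C13.  Closes the `TODO(general form)` left in `QuantumLattice/FermionBlockRGFluctuation.lean`
(«the kernels (49)–(50) with the L² weights of the rescaled lattices») and supplies the input shape of
`Dimock2011to13/QED3PropagatorScaleSums.lean` ((26) ∕ (50) as `Σ_{j<k} L^{p(k−j)}•kernel_j`).)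

**Citation header (reproduction of PUBLISHED work).** J. Dimock, *Quantum electrodynamics on the 3-torus II. The RG
flow*, arXiv:math-ph/0407063v1 (2004) [Dimock2004QED3TorusII]; loci = PDF page ∕ text-layer line of the held layer
`paper:arxiv-math-ph_0407063`.

**What the paper prints (verbatim, text layer).**
* (4) p.3 L57–61: *"Here scaling up by `L` is defined by `A_L(x) = (σ^b_LA)(x) = L^{−1∕2}A(L^{−1}x)`, `Ψ_L(x) = (σ^f_LΨ)(x) =
  L^{−1}Ψ(L^{−1}x)` (4) so that `Ψ_{k+1,L}, A_{k+1,L}` are fields on `T¹_{N+M−k}`"*.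
* (10) p.4 L31–36: *"Here we are integrating over functions `A` on `T^{−k}_{N+M−k}` and the inner product is `(A,A) =
  Σ_x L^{−3k}|A(x)|² ≡ ∫|A(x)|²dx` (10)"*.
* (23) p.6 L8–17 (the flow `G_{k+1} = σ_L^{−1}(G_k + H_kC_kH_k^T)(σ_L^{−1})^T`, … *"(for `k = 0` the conventions are `G_0 = 0`,
  `H_0 = I`, …)"*) and §1.2.4 p.6 L33–47: *"As an operator on functions on `T^{−k}_{N+M−k}`, the propagator `G_k` has a kernel
  `G_k(x,x′)` defined so that `(G_kf)(x) = ∫G_k(x,x′)f(x′)dx′` where again the integral means the weighted sum. Since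
  `σ^T_{L^{−1}} = L^{−2}σ_L` for bosons and `(σ^{−1}_LG_kσ_L)(x,x′) = L³G_k(Lx,Lx′)` and we can write (23) as `G_{k+1}(x,x′) =
  L(G_k(Lx,Lx′) + (H_kC_kH^T_k)(Lx,Lx′))` (25). If we iterate this we find `G_k(x,x′) = Σ_{j=0}^{k−1}L^{k−j}C̃_j(L^{k−j}x,
  L^{k−j}x′)` (26) where `C̃_j = H_jC_jH_j^T` (27)"*.
* §1.3.4 p.9 L32–42: *"For the kernels we can rewrite (47) as `S_{k+1}(A,x,x′) = L²(S_k(A_L,Lx,Lx′) +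
  (H_k(A_L)Γ_k(A_L)H_k(A_L)^T)(Lx,Lx′))` (49). Here we have used `(σ^{−1}_L)^T = L^{−1}σ_L` for fermions. Iterating this
  yields `S_k(A,x,x′) = Σ_{j=0}^{k−1}L^{2(k−j)}Γ̃_j(A_{L^{k−j}};L^{k−j}x,L^{k−j}x′)` (50) where `Γ̃_j(A) = H_j(A)Γ_j(A)H_j(A)^T` (51)
  provided all the operators exist."*; p.9 L26: *"(The convention is that `S_0(A) = 0`, `H_0(A) = I`, …)"*.

**The reading used (declared): INDEX COORDINATES.** Every torus `T^{−j}_{N+M−j}` of the paper (p.3 L13–16) has the same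
site set `I = (ℤ∕L^{N+M}ℤ)³` (site `L^{−j}·i`); the scalings `x ↦ Lx`, `x ↦ L^{−1}x` between consecutive tori are the
IDENTITY on site indices.  Hence in index coordinates `σ_L` of (4) is the scalar map `s·id` with `s = L^{−1∕2}` (bosons) ∕
`s = L^{−1}` (fermions), `σ_{L^{−1}} = σ_L^{−1} = s^{−1}·id`; an operator is a matrix `M : I × I → R` over a commutative
real algebra `R` (`ℝ`; `ℂ` ∕ commuting spinor blocks are covered entrywise); its KERNEL AT SCALE `k` w.r.t. the weighted
sum `∫dx′ = Σ_{x′}L^{−3k}` of (10) is `kernelAt L k M (i,i′) = L^{3k}·M(i,i′)` (`mulVec_eq_sum_kernel`: `(Mf)(i) =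
Σ_{i′}L^{−3k}·kernelAt(i,i′)f(i′)`); and the TRANSPOSE of a map from scale-`k` functions to scale-`(k+1)` functions w.r.t.
the two weighted inner products is `wTransposeUp L A = L^{−3}·Aᵀ` (`wInner_mulVec`: `(Af,g)_{k+1} = (f, wTransposeUp A g)_k`).

**What is reproduced here (kernel-checked, zero `sorry`; three definitions with bodies `kernelAt`, `wTransposeUp`,
`wInner`; no named facts; Mathlib only).**
* **`boson_wTranspose_sigmaInv`**: `σ^T_{L^{−1}} = L^{−2}σ_L` — `wTransposeUp L (√L·1) = L^{−2}·(√L)^{−1}·1`;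
  **`fermion_wTranspose_sigmaInv`**: `(σ_L^{−1})^T = L^{−1}σ_L` — `wTransposeUp L (L·1) = L^{−1}·L^{−1}·1`.
* **`kernelAt_succ_conj`**: `(σ_L^{−1}Xσ_L)(x,x′) = L³X(Lx,Lx′)` — `kernelAt L (k+1) (s^{−1}·1 · X · s·1) = L³·kernelAt L k X`
  (any `s ≠ 0`).
* **`eq25`**: `kernelAt L (k+1) (σ_L^{−1} X σ^T_{L^{−1}}) = L·kernelAt L k X` (bosons, `X = G_k + H_kC_kH_k^T`);
  **`eq49`**: `= L²·kernelAt L k X` (fermions, `X = S_k + H_kΓ_kH_k^T`).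
* **`kernelAt_flow_eq_sum`** (generic: a flow `X_{k+1} = T(X_k + Y_k)`, `X_0 = 0`, whose kernel factor is `q` has
  `kernel_k(X_k) = Σ_{j<k} q^{k−j}·kernel_j(Y_j)`), **`eq26`** (`q = L`: `G_k(i,i′) = Σ_{j<k}L^{k−j}·kernelAt L j C̃_j (i,i′)`) and
  **`eq50`** ∕ **`eq50'`** (`q = L²`: `S_k(i,i′) = Σ_{j<k}L^{2(k−j)}·kernelAt L j Γ̃_j (i,i′)`) — exactly the input shape of
  `QED3PropagatorScaleSums.dimock29_value` ∕ `dimock53`.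

**HONEST SCOPE ∕ what is NOT claimed.** The operator identities (23) ∕ (47) themselves (Gaussian integration; the
unscaled one-step algebra is the tree's `QuantumLattice/FermionBlockRGFluctuation.lean`) are hypotheses here in the form
of the flow `hstep`; the field arguments `A_{L^{k−j}}` of (50) are silent (index-identity reading); existence («provided all
the operators exist») is not discussed — the matrices are given.  Transposes are the REAL-bilinear weighted ones of (10)
(for the fermionic pairing `(Ψ̄,·)` the same matrix transpose enters).  NOT a statement about the ultraviolet problem in
`d = 4`.  Unit `lit-balaban-p11-g21`, HOME `run/shared/lean/pub/lit-balaban/`, 2026-08-22.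
-/

noncomputable section

open Finset Matrix

namespace Literature.MathematicalPhysics.QuantumFieldTheory.Dimock2011to13

namespace QED3TorusII

section Rescaling

variable {I : Type*} {R : Type*} [CommRing R] [Algebra ℝ R]

/-- **The kernel of an operator at scale `k`** (p.6 L33–35: *"`G_k` has a kernel `G_k(x,x′)` defined so that `(G_kf)(x) =
∫G_k(x,x′)f(x′)dx′` where again the integral means the weighted sum"*, `∫dx′ = Σ_{x′}L^{−3k}`): for a matrix `M` on the
site indices, `kernelAt L k M (i,i′) = L^{3k}·M(i,i′)`. [cite: Dimock2004QED3TorusII, §1.2.4 p.6 L33–35 and (10) p.4 L31–36] -/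
def kernelAt (L : ℝ) (k : ℕ) (M : Matrix I I R) : I → I → R := fun i i' => (L ^ (3 * k) : ℝ) • M i i'

/-- **The weighted transpose** of a map `A` from scale-`k` functions to scale-`(k+1)` functions w.r.t. the inner
products (10) at the two scales: `wTransposeUp L A = L^{−3}·Aᵀ` (`wInner_mulVec`). This is the transpose in which the paper's
`σ^T_{L^{−1}}`, `(σ_L^{−1})^T` are taken. [cite: Dimock2004QED3TorusII, (10) p.4 L31–36 and §1.2.4 p.6 L36–42] -/
def wTransposeUp (L : ℝ) (A : Matrix I I R) : Matrix I I R := ((L ^ 3)⁻¹ : ℝ) • Aᵀ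

variable {L : ℝ}

/-- kernels are additive. [cite: Dimock2004QED3TorusII, §1.2.4 (25) p.6 L42 (the sum `G_k + H_kC_kH_k^T` under one kernel)] -/
theorem kernelAt_add (L : ℝ) (k : ℕ) (M N : Matrix I I R) (i i' : I) :
    kernelAt L k (M + N) i i' = kernelAt L k M i i' + kernelAt L k N i i' := by
  simp [kernelAt, Matrix.add_apply, smul_add]

/-- **«If we iterate this we find» (26) ∕ «Iterating this yields» (50), generic form.**  A flow of matrices
`X_{k+1} = T(X_k + Y_k)` with `X_0 = 0` («`G_0 = 0`», «`S_0(A) = 0`») whose one-step map rescales kernels by the factor `q`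
(`kernelAt L (k+1) (T X) = q·kernelAt L k X`: `q = L` by (25), `q = L²` by (49)) has
`kernelAt L k X_k (i,i′) = Σ_{j<k} q^{k−j}·kernelAt L j Y_j (i,i′)`. [cite: Dimock2004QED3TorusII, §1.2.4 (26) p.6 L43–47 and §1.3.4 (50) p.9 L35–39] -/
theorem kernelAt_flow_eq_sum {q : ℝ} (Xm Ym : ℕ → Matrix I I R) (T : Matrix I I R → Matrix I I R)
    (hT : ∀ k X, kernelAt L (k + 1) (T X) = fun i i' => q • kernelAt L k X i i')
    (h0 : Xm 0 = 0) (hstep : ∀ k, Xm (k + 1) = T (Xm k + Ym k)) :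
    ∀ k, kernelAt L k (Xm k) = fun i i' => ∑ j ∈ range k, (q ^ (k - j)) • kernelAt L j (Ym j) i i'
  | 0 => by
      funext i i'
      simp [kernelAt, h0]
  | k + 1 => by
      funext i i'
      have ih := congrFun (congrFun (kernelAt_flow_eq_sum Xm Ym T hT h0 hstep k) i) i'
      rw [hstep, hT]
      show q • kernelAt L k (Xm k + Ym k) i i' = ∑ j ∈ range (k + 1), q ^ (k + 1 - j) • kernelAt L j (Ym j) i i'
      rw [Finset.sum_range_succ, Nat.add_sub_cancel_left, pow_one, kernelAt_add, ih, smul_add, Finset.smul_sum]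
      congr 1
      refine Finset.sum_congr rfl fun j hj => ?_
      rw [smul_smul, ← pow_succ', Nat.succ_sub (mem_range.1 hj).le]

section Weighted

variable [Fintype I]

/-- **The weighted inner product (10) at scale `k`**: `(f,g)_k = Σ_x L^{−3k}f(x)g(x) ≡ ∫f(x)g(x)dx` on functions on
`T^{−k}_{N+M−k}` (index coordinates; values in a commutative real algebra). [cite: Dimock2004QED3TorusII, (10) p.4 L31–36] -/
def wInner (L : ℝ) (k : ℕ) (f g : I → R) : R := ((L ^ (3 * k))⁻¹ : ℝ) • ∑ i, f i * g i

/-- **The kernel convention**: `(Mf)(i) = Σ_{i′} L^{−3k}·kernelAt L k M (i,i′)·f(i′)` = `∫M(x,x′)f(x′)dx′` (`L ≠ 0`).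
[cite: Dimock2004QED3TorusII, §1.2.4 p.6 L33–35] -/
theorem mulVec_eq_sum_kernel (hL : L ≠ 0) (k : ℕ) (M : Matrix I I R) (f : I → R) (i : I) :
    (M *ᵥ f) i = ∑ i', ((L ^ (3 * k))⁻¹ : ℝ) • (kernelAt L k M i i' * f i') := by
  simp only [Matrix.mulVec, dotProduct, kernelAt, smul_mul_assoc, smul_smul,
    inv_mul_cancel₀ (pow_ne_zero _ hL), one_smul]

/-- **`wTransposeUp` IS the weighted transpose**: `(Af, g)_{k+1} = (f, wTransposeUp L A g)_k` for every matrix `A` read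
as a map from scale-`k` to scale-`(k+1)` functions. [cite: Dimock2004QED3TorusII, (10) p.4 L31–36 and §1.2.4 p.6 L36–42] -/
theorem wInner_mulVec (k : ℕ) (A : Matrix I I R) (f g : I → R) :
    wInner L (k + 1) (A *ᵥ f) g = wInner L k f (wTransposeUp L A *ᵥ g) := by
  unfold wInner wTransposeUp
  simp only [Matrix.mulVec, dotProduct, Matrix.smul_apply, Matrix.transpose_apply]
  rw [show 3 * (k + 1) = 3 * k + 3 by ring, pow_add, mul_inv, ← smul_smul]
  congr 1
  calc ((L ^ 3)⁻¹ : ℝ) • ∑ i, (∑ j, A i j * f j) * g i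
      = ∑ i, ∑ j, ((L ^ 3)⁻¹ : ℝ) • (A i j * f j * g i) := by
        rw [Finset.smul_sum]
        refine Finset.sum_congr rfl fun i _ => ?_
        rw [Finset.sum_mul, Finset.smul_sum]
    _ = ∑ j, ∑ i, ((L ^ 3)⁻¹ : ℝ) • (A i j * f j * g i) := Finset.sum_comm
    _ = ∑ i, f i * ∑ j, ((L ^ 3)⁻¹ : ℝ) • A j i * g j := by
        refine Finset.sum_congr rfl fun i _ => ?_
        rw [Finset.mul_sum]
        refine Finset.sum_congr rfl fun j _ => ?_
        rw [smul_mul_assoc, mul_smul_comm]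
        congr 1
        ring

end Weighted

section Scalings

variable [DecidableEq I]

/-- the weighted transpose of a scalar map `s·id` is `(sL^{−3})·id`. [cite: Dimock2004QED3TorusII, §1.2.4 p.6 L36–42] -/
theorem wTransposeUp_smul_one (s : ℝ) :
    wTransposeUp L (s • (1 : Matrix I I R)) = (s * (L ^ 3)⁻¹) • (1 : Matrix I I R) := by
  unfold wTransposeUp
  rw [Matrix.transpose_smul, Matrix.transpose_one, smul_smul, mul_comm]

/-- **«`σ^T_{L^{−1}} = L^{−2}σ_L` for bosons»**: with `σ^b_L = L^{−1∕2}·id` (4) in index coordinates, `σ_{L^{−1}} = √L·id`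
and `wTransposeUp L (√L·1) = L^{−2}·((√L)^{−1}·1) = L^{−2}σ_L` (`L > 0`). [cite: Dimock2004QED3TorusII, §1.2.4 p.6 L36–42 and (4) p.3 L57–61] -/
theorem boson_wTranspose_sigmaInv (hL : 0 < L) :
    wTransposeUp L (Real.sqrt L • (1 : Matrix I I R)) = (L ^ 2)⁻¹ • ((Real.sqrt L)⁻¹ • (1 : Matrix I I R)) := by
  rw [wTransposeUp_smul_one, smul_smul]
  congr 1
  have hs : Real.sqrt L ≠ 0 := (Real.sqrt_pos.2 hL).ne'
  have hss : Real.sqrt L * Real.sqrt L = L := Real.mul_self_sqrt hL.le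
  rw [eq_mul_inv_iff_mul_eq₀ hs]
  field_simp
  nlinarith [hss]

/-- **«`(σ^{−1}_L)^T = L^{−1}σ_L` for fermions»**: with `σ^f_L = L^{−1}·id` (4), `σ_L^{−1} = L·id` and
`wTransposeUp L (L·1) = L^{−1}·(L^{−1}·1) = L^{−1}σ_L` (`L > 0`). [cite: Dimock2004QED3TorusII, §1.3.4 p.9 L34–35 and (4) p.3 L57–61] -/
theorem fermion_wTranspose_sigmaInv (hL : 0 < L) :
    wTransposeUp L (L • (1 : Matrix I I R)) = L⁻¹ • (L⁻¹ • (1 : Matrix I I R)) := by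
  rw [wTransposeUp_smul_one, smul_smul]
  congr 1
  have hL0 : L ≠ 0 := hL.ne'
  rw [show (L ^ 3 : ℝ) = L * (L * L) by ring, mul_inv, mul_inv, ← mul_assoc, mul_inv_cancel₀ hL0, one_mul]

variable [Fintype I]

/-- **«`(σ^{−1}_LG_kσ_L)(x,x′) = L³G_k(Lx,Lx′)`»**: conjugating by the scalar scaling (`σ_L = s·id`, any `s ≠ 0`) does not
change the matrix, and the scale-`(k+1)` kernel carries `L^{3(k+1)} = L³·L^{3k}`. [cite: Dimock2004QED3TorusII, §1.2.4 p.6 L36–42] -/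
theorem kernelAt_succ_conj (hL : L ≠ 0) {s : ℝ} (hs : s ≠ 0) (k : ℕ) (X : Matrix I I R) :
    kernelAt L (k + 1) ((s⁻¹ • (1 : Matrix I I R)) * X * (s • (1 : Matrix I I R)))
      = fun i i' => (L ^ 3 : ℝ) • kernelAt L k X i i' := by
  funext i i'
  simp only [kernelAt, Matrix.smul_mul, Matrix.mul_smul, Matrix.one_mul, Matrix.mul_one, Matrix.smul_apply,
    smul_smul]
  congr 1
  rw [show 3 * (k + 1) = 3 * k + 3 by ring, pow_add]
  field_simp

/-- **(25)**: `G_{k+1}(x,x′) = L·(G_k + H_kC_kH_k^T)(Lx,Lx′)` — for any matrix `X` (`= G_k + H_kC_kH_k^T` by (23)),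
`kernelAt L (k+1) (σ_L^{−1}·X·σ^T_{L^{−1}}) = L·kernelAt L k X` with the boson scaling `σ_L^{−1} = √L·1` and its weighted
transpose. [cite: Dimock2004QED3TorusII, §1.2.4 (25) p.6 L36–42] -/
theorem eq25 (hL : 0 < L) (k : ℕ) (X : Matrix I I R) :
    kernelAt L (k + 1) ((Real.sqrt L • (1 : Matrix I I R)) * X * wTransposeUp L (Real.sqrt L • (1 : Matrix I I R)))
      = fun i i' => (L : ℝ) • kernelAt L k X i i' := by
  rw [boson_wTranspose_sigmaInv hL]
  funext i i'
  have hs : Real.sqrt L ≠ 0 := (Real.sqrt_pos.2 hL).ne'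
  have hss : Real.sqrt L * Real.sqrt L = L := Real.mul_self_sqrt hL.le
  simp only [kernelAt, Matrix.smul_mul, Matrix.mul_smul, Matrix.one_mul, Matrix.mul_one, Matrix.smul_apply,
    smul_smul]
  congr 1
  rw [show 3 * (k + 1) = 3 * k + 3 by ring, pow_add]
  have hL0 : L ≠ 0 := hL.ne'
  have e1 : (L ^ 3 : ℝ) = L * (Real.sqrt L * Real.sqrt L) * (Real.sqrt L * Real.sqrt L) := by rw [hss]; ring
  rw [e1]
  field_simp
  rw [show Real.sqrt L ^ 4 = (Real.sqrt L * Real.sqrt L) ^ 2 by ring, hss]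

/-- **(49)**: `S_{k+1}(A,x,x′) = L²·(S_k(A_L) + H_k(A_L)Γ_k(A_L)H_k(A_L)^T)(Lx,Lx′)` — for any matrix `X` (`= S_k + H_kΓ_kH_k^T`
by (47)), `kernelAt L (k+1) (σ_L^{−1}·X·(σ_L^{−1})^T) = L²·kernelAt L k X` with the fermion scaling `σ_L^{−1} = L·1`.
[cite: Dimock2004QED3TorusII, §1.3.4 (49) p.9 L32–35] -/
theorem eq49 (hL : 0 < L) (k : ℕ) (X : Matrix I I R) :
    kernelAt L (k + 1) ((L • (1 : Matrix I I R)) * X * wTransposeUp L (L • (1 : Matrix I I R)))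
      = fun i i' => (L ^ 2 : ℝ) • kernelAt L k X i i' := by
  rw [fermion_wTranspose_sigmaInv hL]
  funext i i'
  simp only [kernelAt, Matrix.smul_mul, Matrix.mul_smul, Matrix.one_mul, Matrix.mul_one, Matrix.smul_apply,
    smul_smul]
  congr 1
  rw [show 3 * (k + 1) = 3 * k + 3 by ring, pow_add]
  field_simp

/-- **(26)**: iterating (25) from `G_0 = 0`: `G_k(x,x′) = Σ_{j<k}L^{k−j}C̃_j(L^{k−j}x,L^{k−j}x′)`, i.e. in index coordinates
`kernelAt L k G_k (i,i′) = Σ_{j<k}L^{k−j}·kernelAt L j C̃_j (i,i′)` for the flow `G_{k+1} = σ_L^{−1}(G_k + C̃_k)σ^T_{L^{−1}}`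
(`C̃_k = H_kC_kH_k^T`, (27)). [cite: Dimock2004QED3TorusII, §1.2.4 (26)–(27) p.6 L43–50] -/
theorem eq26 (hL : 0 < L) (Gm Cm : ℕ → Matrix I I R) (h0 : Gm 0 = 0)
    (hstep : ∀ k, Gm (k + 1) = (Real.sqrt L • (1 : Matrix I I R)) * (Gm k + Cm k)
      * wTransposeUp L (Real.sqrt L • (1 : Matrix I I R))) (k : ℕ) :
    kernelAt L k (Gm k) = fun i i' => ∑ j ∈ range k, (L ^ (k - j)) • kernelAt L j (Cm j) i i' :=
  kernelAt_flow_eq_sum Gm Cm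
    (fun X => (Real.sqrt L • (1 : Matrix I I R)) * X * wTransposeUp L (Real.sqrt L • (1 : Matrix I I R)))
    (fun k X => eq25 hL k X) h0 hstep k

/-- **(50)**: iterating (49) from `S_0 = 0`: `S_k(A,x,x′) = Σ_{j<k}L^{2(k−j)}Γ̃_j(A_{L^{k−j}};L^{k−j}x,L^{k−j}x′)`, i.e.
`kernelAt L k S_k (i,i′) = Σ_{j<k}(L²)^{k−j}·kernelAt L j Γ̃_j (i,i′)` for the flow `S_{k+1} = σ_L^{−1}(S_k + Γ̃_k)(σ_L^{−1})^T`
(`Γ̃_k = H_kΓ_kH_k^T`, (51); the field arguments are silent in index coordinates). [cite: Dimock2004QED3TorusII, §1.3.4 (50)–(51) p.9 L35–42] -/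
theorem eq50 (hL : 0 < L) (Sm Gt : ℕ → Matrix I I R) (h0 : Sm 0 = 0)
    (hstep : ∀ k, Sm (k + 1) = (L • (1 : Matrix I I R)) * (Sm k + Gt k)
      * wTransposeUp L (L • (1 : Matrix I I R))) (k : ℕ) :
    kernelAt L k (Sm k) = fun i i' => ∑ j ∈ range k, ((L ^ 2) ^ (k - j)) • kernelAt L j (Gt j) i i' :=
  kernelAt_flow_eq_sum Sm Gt
    (fun X => (L • (1 : Matrix I I R)) * X * wTransposeUp L (L • (1 : Matrix I I R)))
    (fun k X => eq49 hL k X) h0 hstep k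

/-- **(50), exponent as printed** `L^{2(k−j)}`: `kernelAt L k S_k (i,i′) = Σ_{j<k}L^{2(k−j)}·kernelAt L j Γ̃_j (i,i′)` — the input
shape of `QED3PropagatorScaleSums.dimock53`. [cite: Dimock2004QED3TorusII, §1.3.4 (50) p.9 L35–39] -/
theorem eq50' (hL : 0 < L) (Sm Gt : ℕ → Matrix I I R) (h0 : Sm 0 = 0)
    (hstep : ∀ k, Sm (k + 1) = (L • (1 : Matrix I I R)) * (Sm k + Gt k)
      * wTransposeUp L (L • (1 : Matrix I I R))) (k : ℕ) (i i' : I) :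
    kernelAt L k (Sm k) i i' = ∑ j ∈ range k, (L ^ (2 * (k - j))) • kernelAt L j (Gt j) i i' := by
  rw [eq50 hL Sm Gt h0 hstep k]
  exact Finset.sum_congr rfl fun j _ => by rw [← pow_mul]

end Scalings

end Rescaling

end QED3TorusII

end Literature.MathematicalPhysics.QuantumFieldTheory.Dimock2011to13
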